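import Summits.AtomisticToContinuum.Crystallization.Theorems.ChartedZeroExcessLayeredLatticeLiouvilleZZZX

/-!
# ChartedZeroExcess · LayeredLatticeLiouville ZZZXA (lens-2 g89 NODE 89 part 3b «LabelTree», ADDENDUM to tree ZZZX) — THE FATNESS TRANSFER DISCHARGED:
# (RGᴸ) GRAPH RIGIDITY REDUCED TO THE GEOMETRY OF THE LABELS ALONE.  Tree ZZZX (part 3, critic row 1591, GO (73), landed) reduces (RGᴸ) `DeficitRigidityP` to
# (RG-geo) `CoreFrameTreeP`, whose fatness clause speaks of the ADVERSARY's filling `y` (critic row 1591 (ii): "(G3) fatness transfer through the tube must turn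
# label-side fatness μ_lab into μ₀ = μ_lab − O(tube width) explicitly").  This addendum does (G3) ONCE AND FOR ALL inside the finite-dimensional lemma, by a
# BOOTSTRAP ON THE OPERATOR NORM, and restates the S-side leaf y-FREE and V-FREE:
#   (RG-lab) `CoreLabelTreeP … Rd N₀ H₀ μC ΔC …` = under the binders of (RGᴸ) up to the bond label (verbatim) and NOTHING ELSE (no filling, no tube, no rotation
#   field, no deficit): the core has `n ≤ N₀` sites and, if non-empty, its LABELS `lab ∘ xf` carry a rooted spanning frame tree `IsLabelTree Rd μC ΔC H₀ …`
#   (parent and tripod in range `Rd`, LABEL tripod vectors `μC`-fat in `ℓ¹`, label diameter `≤ ΔC`);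
#   (RG-fin′) `rigidMisfit_root_le_of_labelTree`: for EVERY rotation field `V`, every reference `y₀` with such a tree and every filling `y` whose tripod vectors are
#   within `sv < μ` and whose sites are within `dB` of the reference, `rigidMisfit y xf (V i₀) (xf i₀ − V i₀ (y i₀)) ≤ n·H²·(1 + 3(ΔC + 2dB)/(μ − sv))²·coreDeficit
#   Rd y₀ y xf V` (PROVED);
#   the GLUE `deficitRigidityP_of_coreLabelTree`: (RGᴸ)(`Rg sb₁ dI₁ dB₁ Rd`, `cR = 1/(N₀·H₀²·(1 + 3(ΔC + 2dB₁)/(μC − sb₁))²)`) ⟸ (RG-lab)(`Rd N₀ H₀ μC ΔC`) for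
#   `Rd ≤ Rg`, `0 ≤ sb₁ < μC` (PROVED — the vector bond tube supplies `sv := sb₁`, `dB := dB₁`);
#   the DOORS `mildCoherentMoatCorePG_W2c_of_labelTree` (σ₀-gap form) and ★ `mildCoherentMoatCorePG_W2c_exactWell_labelTree`:
#   `[MCMC♮](ϑc) ⟸ (SC♮) ∧ (X1ᴸ)(lam > 0) ∧ (X2ᴸ) ∧ (RG-lab)(N₀, H₀, μC, ΔC) ∧ (DWᴹ)(cE, 0)`, `0 < cE`, `249/20000 < μC`, `0 ≤ ΔC` (PROVED) — the exact-well
#   door of record (tree ZZZX) with its leaf (RG-geo) replaced by the WEAKER-TO-PROVE, y-free (RG-lab).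
# 0 sorry · import = tree ZZZX only · 2 Prop-defs (`IsLabelTree`, `CoreLabelTreeP`) · no instances/notation · axioms standard.

THE BOOTSTRAP (one edge of the tree, `labelTree_parent_sub_le`): the frames `A_p`, `A_j` (`A_i z = V i (z − y i) + xf i`, tree ZZZX `siteFrame`) of a parent/child
pair agree within `√D` at `y j` and within `2√D` at the three tripod sites, so `W := V p − V j` (a continuous linear map) is `≤ 3√D` on the FILLING's tripod
vectors `u_m = y (t j m) − y j`, hence `≤ 3√D + ‖W‖·sv` on the LABEL tripod vectors `u⁰_m` (`‖u_m − u⁰_m‖ ≤ sv`, the vector bond clause); expanding any `z` in the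
label tripod with `Σ|α| ≤ ‖z‖/μ` gives `‖W z‖ ≤ ((3√D + ‖W‖·sv)/μ)·‖z‖`, i.e. `‖W‖ ≤ (3√D + ‖W‖·sv)/μ` (`ContinuousLinearMap.opNorm_le_bound`), i.e.
`‖W‖ ≤ 3√D/(μ − sv)` — no perturbed-basis inverse, no determinant, no cross product.  With `‖y k − y j‖ ≤ ΔC + 2dB` the two frames differ by
`≤ (1 + 3(ΔC + 2dB)/(μ − sv))·√D` everywhere; the depth induction and the ℓ²-sum are as in tree ZZZX.

WHAT REMAINS S-SIDE, (RG-lab) [KINEMATIC · LJ-free · y-free · V-free · deficit-free · S-SIDE COMBINATORIAL GEOMETRY · NEW · UNDECIDED · TRUE-type at `Rd = 121/25` ·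
ATTACKABLE-S · size M]: (G1) BFS tree of the core bond graph (`isBond_iff_of_isDoorSetP`) rooted at any core atom, `H₀ ≤` hop-eccentricity; (G2) core-side
non-coplanar LABEL tripod at every non-root core atom (toward the nearest container atom at least three first-shell neighbours lie in the core; no three
same-side first-shell vectors of fcc/hcp are coplanar; `lab` on a star is a graph isomorphism of (anti)cuboctahedra, hence a point-group image — finite Barlow
case tables as in tree ZZZV); (G4) `N₀` by hard-core packing `card_le_of_separated_of_dist_le`; (G5) `ΔC` along label chains.  (G3) of memo NODE-g89-part3 §2 is
NO LONGER OWED.  Why it might fail: a core atom all of whose in-core bonded neighbours have coplanar label vectors (excluded by the first-shell table), or a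
mis-set constant (only `0 < N₀, 0 < H₀, 249/20000 < μC, 0 ≤ ΔC` are consumed downstream).

Main results, all PROVED (0 sorry): `IsLabelTree`; `labelTree_parent_sub_le` (one edge, operator-norm bootstrap), `labelTree_sub_root_le` (depth induction),
★ `rigidMisfit_root_le_of_labelTree` (RG-fin′); `CoreLabelTreeP` (RG-lab); `labelChainRigidityConst_pos`; ★ `deficitRigidityP_of_coreLabelTree` (glue, explicit
`cR`); doors ★ `mildCoherentMoatCorePG_W2c_of_labelTree` and ★★ `mildCoherentMoatCorePG_W2c_exactWell_labelTree`.  Reused from tree ZZZX: `siteFrame`,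
`siteFrame_self`, `siteFrame_sub`, `dist_siteFrame_le_sqrt`, and (through the doors) tree ZZZWB `mildCoherentMoatCorePG_W2c_of_labelChain`.
-/

noncomputable section
open scoped BigOperators Classical InnerProductSpace RealInnerProductSpace
open MeasureTheory Set Metric Filter Topology
open Literature.Geometry.DiscreteGeometry (IsTwoShellGoodSet)
open Literature.MathematicalPhysics.StatisticalMechanics (lennardJones card_le_of_separated_of_dist_le)

namespace Summit.AtomisticToContinuum.Crystallization.Theorems.ChartedZeroExcessLayeredLatticeLiouville

open Summit.AtomisticToContinuum.Crystallization.Theorems.ChartedPlanarOrderRigidityDoor (E3 IsClean atomsIn)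
open Summit.AtomisticToContinuum.Crystallization.Theorems.ChartedPlanarOrderDensityDichotomy (μS IsSep)
open Summit.AtomisticToContinuum.Crystallization.Theorems.ChartedPlanarOrderCleanScaleP (IsCleanP IsDoorSetP)
open Summit.AtomisticToContinuum.Crystallization.Theorems.ChartedPlanarOrderMesoCut (LayeredHom EnvClose)
open Summit.AtomisticToContinuum.Crystallization.Theorems.ChartedPlanarOrderDoorLayeredOsc (IsTwoShellAffineGood)

/-! ### ZZZXA-1  (RG-fin′) chain-Poincaré rigidity along a LABEL frame tree, fatness transfer by operator-norm bootstrap (finite-dimensional, PROVED) -/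

section LabelTree

variable {n : ℕ} {Rd μ sv dB ΔC : ℝ} {H : ℕ} {y₀ y xf : Fin n → E3} {V : Fin n → (E3 ≃ₗᵢ[ℝ] E3)}

/-- ★ **`IsLabelTree Rd μ ΔC H y₀ i₀ par dep t`** — a ROOTED SPANNING FRAME TREE OF THE REFERENCE (the labels) `y₀ : Fin n → E3`: root `i₀`, parent map `par`
strictly decreasing the depth `dep ≤ H`, every non-root site IN RANGE `Rd` of its parent, a TRIPOD `t j : Fin 3 → Fin n` of sites in range of both `j` and
`par j` whose REFERENCE difference vectors `y₀ (t j k) − y₀ j` span `E3` with `ℓ¹`-coefficient bound `‖z‖/μ` (FATNESS `μ`), and reference diameter `≤ ΔC`.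
A property of the labelled core ALONE — no filling, no rotation field, no deficit. [this file, g89] -/
def IsLabelTree (Rd μ ΔC : ℝ) (H : ℕ) (y₀ : Fin n → E3) (i₀ : Fin n) (par : Fin n → Fin n) (dep : Fin n → ℕ) (t : Fin n → Fin 3 → Fin n) : Prop :=
  (∀ j, dep j = 0 → j = i₀) ∧ (∀ j, dep j ≠ 0 → dep (par j) < dep j) ∧ (∀ j, dep j ≤ H) ∧
    (∀ j, dep j ≠ 0 → dist (y₀ (par j)) (y₀ j) ≤ Rd) ∧
      (∀ j, dep j ≠ 0 → ∀ k, dist (y₀ (par j)) (y₀ (t j k)) ≤ Rd ∧ dist (y₀ j) (y₀ (t j k)) ≤ Rd) ∧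
        (∀ j, dep j ≠ 0 → ∀ z : E3, ∃ α : Fin 3 → ℝ, z = ∑ k, α k • (y₀ (t j k) - y₀ j) ∧ ∑ k, |α k| ≤ ‖z‖ / μ) ∧
          ∀ i k, dist (y₀ k) (y₀ i) ≤ ΔC

variable {i₀ : Fin n} {par : Fin n → Fin n} {dep : Fin n → ℕ} {t : Fin n → Fin 3 → Fin n}

/-- ONE EDGE OF THE TREE (PROVED): if the filling `y` has its tripod vectors within `sv < μ` of the reference ones and its sites within `dB` of the reference,
the frames of a site and of its parent differ, at every site, by at most `(1 + 3(ΔC + 2dB)/(μ − sv))·√D`.  The linear parts `W = V p − V j` are compared by a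
BOOTSTRAP on the operator norm: `‖W‖ ≤ (3√D + ‖W‖·sv)/μ`, hence `‖W‖ ≤ 3√D/(μ − sv)` — no inverse, no determinant, no cross product. -/
theorem labelTree_parent_sub_le (hs : 0 ≤ sv) (hsμ : sv < μ) (hT : IsLabelTree Rd μ ΔC H y₀ i₀ par dep t)
    (htube : ∀ j, dep j ≠ 0 → ∀ k, ‖(y (t j k) - y j) - (y₀ (t j k) - y₀ j)‖ ≤ sv) (hpin : ∀ i, dist (y i) (y₀ i) ≤ dB) (j : Fin n)
    (hj : dep j ≠ 0) (k : Fin n) :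
    ‖siteFrame y xf V (par j) (y k) - siteFrame y xf V j (y k)‖ ≤ (1 + 3 * (ΔC + 2 * dB) / (μ - sv)) * Real.sqrt (coreDeficit Rd y₀ y xf V) := by
  obtain ⟨_, _, _, hpar, htri, hfat, hdiam⟩ := hT
  have hμ : 0 < μ := lt_of_le_of_lt hs hsμ
  have hμs : 0 < μ - sv := sub_pos.2 hsμ
  set D := Real.sqrt (coreDeficit Rd y₀ y xf V) with hD
  have hD0 : 0 ≤ D := Real.sqrt_nonneg _
  set p := par j with hp
  -- the two frames agree at `y j` up to `√D`
  have h0 : ‖siteFrame y xf V p (y j) - siteFrame y xf V j (y j)‖ ≤ D := by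
    rw [siteFrame_self, ← norm_neg, neg_sub]
    exact dist_siteFrame_le_sqrt p j (hpar j hj)
  -- and at the three tripod sites up to `2√D`
  have h1 : ∀ m, ‖siteFrame y xf V p (y (t j m)) - siteFrame y xf V j (y (t j m))‖ ≤ 2 * D := by
    intro m
    have a := dist_siteFrame_le_sqrt (xf := xf) (y := y) (V := V) p (t j m) (htri j hj m).1
    have b := dist_siteFrame_le_sqrt (xf := xf) (y := y) (V := V) j (t j m) (htri j hj m).2
    calc ‖siteFrame y xf V p (y (t j m)) - siteFrame y xf V j (y (t j m))‖
        ≤ ‖siteFrame y xf V p (y (t j m)) - xf (t j m)‖ + ‖xf (t j m) - siteFrame y xf V j (y (t j m))‖ := norm_sub_le_norm_sub_add_norm_sub _ _ _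
      _ ≤ D + D := by rw [← norm_neg, neg_sub] ; exact add_le_add a b
      _ = 2 * D := by ring
  -- hence the linear parts differ by at most `3√D` on each tripod vector of the FILLING
  have h2 : ∀ m, ‖V p (y (t j m) - y j) - V j (y (t j m) - y j)‖ ≤ 3 * D := by
    intro m
    have e : V p (y (t j m) - y j) - V j (y (t j m) - y j) =
        (siteFrame y xf V p (y (t j m)) - siteFrame y xf V j (y (t j m))) - (siteFrame y xf V p (y j) - siteFrame y xf V j (y j)) := by
      rw [← siteFrame_sub p, ← siteFrame_sub j]; abel
    rw [e]
    calc ‖(siteFrame y xf V p (y (t j m)) - siteFrame y xf V j (y (t j m))) - (siteFrame y xf V p (y j) - siteFrame y xf V j (y j))‖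
        ≤ ‖siteFrame y xf V p (y (t j m)) - siteFrame y xf V j (y (t j m))‖ + ‖siteFrame y xf V p (y j) - siteFrame y xf V j (y j)‖ := norm_sub_le _ _
      _ ≤ 2 * D + D := add_le_add (h1 m) h0
      _ = 3 * D := by ring
  -- the difference of the linear parts as a continuous linear map
  set W : E3 →L[ℝ] E3 := LinearMap.toContinuousLinearMap (((V p).toLinearEquiv : E3 →ₗ[ℝ] E3) - ((V j).toLinearEquiv : E3 →ₗ[ℝ] E3)) with hWdef
  have hW : ∀ z, W z = V p z - V j z := fun z => rfl
  have hWop : ∀ z, ‖V p z - V j z‖ ≤ ‖W‖ * ‖z‖ := fun z => by rw [← hW]; exact W.le_opNorm z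
  have hW0 : 0 ≤ ‖W‖ := norm_nonneg _
  -- on the REFERENCE tripod vectors: `≤ 3√D + ‖W‖·sv`
  have h2' : ∀ m, ‖V p (y₀ (t j m) - y₀ j) - V j (y₀ (t j m) - y₀ j)‖ ≤ 3 * D + ‖W‖ * sv := by
    intro m
    have e : V p (y₀ (t j m) - y₀ j) - V j (y₀ (t j m) - y₀ j) = (V p (y (t j m) - y j) - V j (y (t j m) - y j)) -
        (V p ((y (t j m) - y j) - (y₀ (t j m) - y₀ j)) - V j ((y (t j m) - y j) - (y₀ (t j m) - y₀ j))) := by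
      simp only [map_sub]; abel
    rw [e]
    calc ‖(V p (y (t j m) - y j) - V j (y (t j m) - y j)) -
          (V p ((y (t j m) - y j) - (y₀ (t j m) - y₀ j)) - V j ((y (t j m) - y j) - (y₀ (t j m) - y₀ j)))‖
        ≤ ‖V p (y (t j m) - y j) - V j (y (t j m) - y j)‖ +
            ‖V p ((y (t j m) - y j) - (y₀ (t j m) - y₀ j)) - V j ((y (t j m) - y j) - (y₀ (t j m) - y₀ j))‖ := norm_sub_le _ _
      _ ≤ 3 * D + ‖W‖ * ‖(y (t j m) - y j) - (y₀ (t j m) - y₀ j)‖ := add_le_add (h2 m) (hWop _)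
      _ ≤ 3 * D + ‖W‖ * sv := by gcongr; exact htube j hj m
  -- BOOTSTRAP: by reference fatness `‖W z‖ ≤ ((3√D + ‖W‖·sv)/μ)·‖z‖` for every `z`, hence `‖W‖ ≤ (3√D + ‖W‖·sv)/μ`, hence `‖W‖ ≤ 3√D/(μ − sv)`
  have hall : ∀ z : E3, ‖W z‖ ≤ (3 * D + ‖W‖ * sv) / μ * ‖z‖ := by
    intro z
    obtain ⟨α, hz, hα⟩ := hfat j hj z
    have hV : ∀ V' : E3 ≃ₗᵢ[ℝ] E3, V' z = ∑ m, α m • V' (y₀ (t j m) - y₀ j) := by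
      intro V'
      rw [hz, map_sum]
      exact Finset.sum_congr rfl fun m _ => map_smul V' (α m) _
    have hlin : W z = ∑ m, α m • (V p (y₀ (t j m) - y₀ j) - V j (y₀ (t j m) - y₀ j)) := by
      rw [hW, hV (V p), hV (V j), ← Finset.sum_sub_distrib]
      exact Finset.sum_congr rfl fun m _ => (smul_sub (α m) _ _).symm
    rw [hlin]
    calc ‖∑ m, α m • (V p (y₀ (t j m) - y₀ j) - V j (y₀ (t j m) - y₀ j))‖
        ≤ ∑ m, ‖α m • (V p (y₀ (t j m) - y₀ j) - V j (y₀ (t j m) - y₀ j))‖ := norm_sum_le _ _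
      _ ≤ ∑ m, |α m| * (3 * D + ‖W‖ * sv) := Finset.sum_le_sum fun m _ => by
            rw [norm_smul, Real.norm_eq_abs]; exact mul_le_mul_of_nonneg_left (h2' m) (abs_nonneg _)
      _ = (∑ m, |α m|) * (3 * D + ‖W‖ * sv) := by rw [Finset.sum_mul]
      _ ≤ ‖z‖ / μ * (3 * D + ‖W‖ * sv) := mul_le_mul_of_nonneg_right hα (by positivity)
      _ = (3 * D + ‖W‖ * sv) / μ * ‖z‖ := by ring
  have hM : ‖W‖ ≤ (3 * D + ‖W‖ * sv) / μ := ContinuousLinearMap.opNorm_le_bound W (by positivity) hall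
  have hM' : ‖W‖ ≤ 3 * D / (μ - sv) := by
    rw [le_div_iff₀ hμs, mul_sub]
    have h := (le_div_iff₀ hμ).1 hM
    linarith
  -- on the vector `y k − y j` (length `≤ ΔC + 2dB`)
  have hkj : ‖y k - y j‖ ≤ ΔC + 2 * dB := by
    rw [← dist_eq_norm]
    calc dist (y k) (y j) ≤ dist (y k) (y₀ k) + dist (y₀ k) (y₀ j) + dist (y₀ j) (y j) := dist_triangle4 _ _ _ _
      _ ≤ dB + ΔC + dB := by
          refine add_le_add (add_le_add (hpin k) (hdiam j k)) ?_
          rw [dist_comm]; exact hpin j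
      _ = ΔC + 2 * dB := by ring
  have hdB0 : 0 ≤ dB := le_trans dist_nonneg (hpin j)
  have hΔ0 : 0 ≤ ΔC := le_trans dist_nonneg (hdiam j j)
  have h3 : ‖V p (y k - y j) - V j (y k - y j)‖ ≤ 3 * D / (μ - sv) * (ΔC + 2 * dB) :=
    calc ‖V p (y k - y j) - V j (y k - y j)‖ ≤ ‖W‖ * ‖y k - y j‖ := hWop _
      _ ≤ 3 * D / (μ - sv) * (ΔC + 2 * dB) := mul_le_mul hM' hkj (norm_nonneg _) (by positivity)
  -- assemble: `A_p (y k) − A_j (y k) = (V p − V j)(y k − y j) + (A_p (y j) − A_j (y j))`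
  have e2 : siteFrame y xf V p (y k) - siteFrame y xf V j (y k) =
      (V p (y k - y j) - V j (y k - y j)) + (siteFrame y xf V p (y j) - siteFrame y xf V j (y j)) := by
    rw [← siteFrame_sub p, ← siteFrame_sub j]; abel
  rw [e2]
  calc ‖(V p (y k - y j) - V j (y k - y j)) + (siteFrame y xf V p (y j) - siteFrame y xf V j (y j))‖
      ≤ ‖V p (y k - y j) - V j (y k - y j)‖ + ‖siteFrame y xf V p (y j) - siteFrame y xf V j (y j)‖ := norm_add_le _ _
    _ ≤ 3 * D / (μ - sv) * (ΔC + 2 * dB) + D := add_le_add h3 h0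
    _ = (1 + 3 * (ΔC + 2 * dB) / (μ - sv)) * D := by
        field_simp
        ring

/-- ALONG THE TREE (PROVED): the frame of a site of depth `d` differs from the ROOT frame, at every site, by at most `d·(1 + 3(ΔC + 2dB)/(μ − sv))·√D`. -/
theorem labelTree_sub_root_le (hs : 0 ≤ sv) (hsμ : sv < μ) (hT : IsLabelTree Rd μ ΔC H y₀ i₀ par dep t)
    (htube : ∀ j, dep j ≠ 0 → ∀ k, ‖(y (t j k) - y j) - (y₀ (t j k) - y₀ j)‖ ≤ sv) (hpin : ∀ i, dist (y i) (y₀ i) ≤ dB) :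
    ∀ (d : ℕ) (j : Fin n), dep j ≤ d → ∀ k : Fin n,
      ‖siteFrame y xf V j (y k) - siteFrame y xf V i₀ (y k)‖ ≤ d * ((1 + 3 * (ΔC + 2 * dB) / (μ - sv)) * Real.sqrt (coreDeficit Rd y₀ y xf V)) := by
  have hroot := hT.1
  have hdec := hT.2.1
  have hc : 0 ≤ (1 + 3 * (ΔC + 2 * dB) / (μ - sv)) * Real.sqrt (coreDeficit Rd y₀ y xf V) := by
    have hΔ : 0 ≤ ΔC := le_trans dist_nonneg (hT.2.2.2.2.2.2 i₀ i₀)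
    have hdB0 : 0 ≤ dB := le_trans dist_nonneg (hpin i₀)
    have hμs : 0 < μ - sv := sub_pos.2 hsμ
    positivity
  intro d
  induction d with
  | zero =>
      intro j hj k
      rw [hroot j (Nat.le_zero.1 hj), sub_self, norm_zero, Nat.cast_zero, zero_mul]
  | succ d ih =>
      intro j hj k
      by_cases h0 : dep j = 0
      · rw [hroot j h0, sub_self, norm_zero]
        positivity
      · have hp : dep (par j) ≤ d := Nat.lt_succ_iff.1 (lt_of_lt_of_le (hdec j h0) hj)
        have e := ih (par j) hp k
        have f := labelTree_parent_sub_le (xf := xf) (V := V) hs hsμ hT htube hpin j h0 k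
        rw [← norm_neg, neg_sub] at f
        calc ‖siteFrame y xf V j (y k) - siteFrame y xf V i₀ (y k)‖
            ≤ ‖siteFrame y xf V j (y k) - siteFrame y xf V (par j) (y k)‖ + ‖siteFrame y xf V (par j) (y k) - siteFrame y xf V i₀ (y k)‖ :=
              norm_sub_le_norm_sub_add_norm_sub _ _ _
          _ ≤ (1 + 3 * (ΔC + 2 * dB) / (μ - sv)) * Real.sqrt (coreDeficit Rd y₀ y xf V) +
                d * ((1 + 3 * (ΔC + 2 * dB) / (μ - sv)) * Real.sqrt (coreDeficit Rd y₀ y xf V)) := add_le_add f e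
          _ = (d + 1 : ℕ) * ((1 + 3 * (ΔC + 2 * dB) / (μ - sv)) * Real.sqrt (coreDeficit Rd y₀ y xf V)) := by push_cast; ring

/-- ★★★ **(RG-fin) CHAIN-POINCARÉ RIGIDITY (PROVED, finite-dimensional)**: on a labelled configuration whose REFERENCE carries a rooted spanning frame tree
(depth `≤ H`, fatness `μ`, diameter `ΔC`) and whose filling `y` has tripod vectors within `sv < μ` and sites within `dB` of the reference (the VECTOR bond tube),
the ℓ²-misfit of the core `xf` from the ROOT FRAME's rigid copy of `y` — rotation `V i₀` (proper whenever the adversary's field is), translation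
`xf i₀ − V i₀ (y i₀)` — is at most `n·H²·(1 + 3(ΔC + 2dB)/(μ − sv))² ×` the sitewise-co-rotated deficit, FOR EVERY rotation field `V`.  The
finite-dimensional content of (RGᴸ) `DeficitRigidityP`; the constant is irrelevant for the W2 line (at `σ₀ = 0` only `cR > 0` is consumed, memo SCOPE-RG-g89 §1,
critic row 1586). [this file, g89] -/
theorem rigidMisfit_root_le_of_labelTree (hs : 0 ≤ sv) (hsμ : sv < μ) (hT : IsLabelTree Rd μ ΔC H y₀ i₀ par dep t)
    (htube : ∀ j, dep j ≠ 0 → ∀ k, ‖(y (t j k) - y j) - (y₀ (t j k) - y₀ j)‖ ≤ sv) (hpin : ∀ i, dist (y i) (y₀ i) ≤ dB) :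
    rigidMisfit y xf (V i₀) (xf i₀ - V i₀ (y i₀)) ≤ n * H ^ 2 * (1 + 3 * (ΔC + 2 * dB) / (μ - sv)) ^ 2 * coreDeficit Rd y₀ y xf V := by
  set c := (1 + 3 * (ΔC + 2 * dB) / (μ - sv)) * Real.sqrt (coreDeficit Rd y₀ y xf V) with hc
  have hH := hT.2.2.1
  have hsite : ∀ j, ‖xf j - (V i₀ (y j) + (xf i₀ - V i₀ (y i₀)))‖ ^ 2 ≤ (H * c) ^ 2 := by
    intro j
    have e : V i₀ (y j) + (xf i₀ - V i₀ (y i₀)) = siteFrame y xf V i₀ (y j) := by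
      simp only [siteFrame, map_sub]; abel
    have h := labelTree_sub_root_le (xf := xf) (V := V) hs hsμ hT htube hpin H j (hH j) j
    rw [siteFrame_self] at h
    rw [e]
    exact pow_le_pow_left₀ (norm_nonneg _) h 2
  calc rigidMisfit y xf (V i₀) (xf i₀ - V i₀ (y i₀)) = ∑ j, ‖xf j - (V i₀ (y j) + (xf i₀ - V i₀ (y i₀)))‖ ^ 2 := rfl
    _ ≤ ∑ _j : Fin n, (H * c) ^ 2 := Finset.sum_le_sum fun j _ => hsite j
    _ = n * (H * c) ^ 2 := by rw [Finset.sum_const, Finset.card_univ, Fintype.card_fin, nsmul_eq_mul]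
    _ = n * H ^ 2 * (1 + 3 * (ΔC + 2 * dB) / (μ - sv)) ^ 2 * (Real.sqrt (coreDeficit Rd y₀ y xf V)) ^ 2 := by rw [hc]; ring
    _ = n * H ^ 2 * (1 + 3 * (ΔC + 2 * dB) / (μ - sv)) ^ 2 * coreDeficit Rd y₀ y xf V := by rw [Real.sq_sqrt coreDeficit_nonneg]

end LabelTree

/-! ### ZZZXA-2  (RG-lab) the y-free S-side leaf and the glue (RGᴸ) ⟸ (RG-lab) (PROVED) -/

section Reduction

/-- ★★★ **(RG-lab) «CoreLabelTreeP … Rd N₀ H₀ μC ΔC …» — THE LABELLED CORE CARRIES A BOUNDED, FAT, SHALLOW SPANNING FRAME TREE.**  Under the binders of (RGᴸ)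
`DeficitRigidityP` up to the bond label (verbatim: θ-good `aHi`-door set, LJ summable, equilibrium chart, container, `ϑp`-mild `rm`-core, `ϑc`-cool moat,
enumerated `ρ`-core `xf`, cool shadow crystal, bond label `lab`) — and NOTHING ELSE: no filling, no tube, no rotation field, no deficit — the core has AT
MOST `N₀` sites, and if it is non-empty there are a root `i₀`, a parent map, a depth map `≤ H₀` and tripods forming an `IsLabelTree Rd μC ΔC H₀ (lab ∘ xf) …`
(parent and tripod IN RANGE `Rd` for the labels, LABEL tripod vectors `μC`-fat, label diameter `≤ ΔC`).  KINEMATIC · LJ-free · y-free · V-free · S-SIDE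
combinatorial geometry of the labelled core · NEW · UNDECIDED · TRUE-type at `Rd = 121/25` for suitable explicit `(N₀, H₀, μC, ΔC)` (BFS tree of the core
bond graph rooted in `K`; toward the nearest container atom at least three first-shell neighbours lie in the core and no three same-side first-shell
vectors of fcc/hcp are coplanar; `lab` restricted to a star is a graph isomorphism of (anti)cuboctahedra, hence a point-group image; packing) ·
ATTACKABLE-S · size M.  Why it might fail: a core atom all of whose in-core bonded neighbours have coplanar label vectors (excluded by the first-shell case
table), or a mis-set constant (only positivity of the constants is consumed downstream).  Sources: this file's docstring; FJM 2002 §3 (discrete rigidity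
by chaining local frames); tree ZZZV (Barlow first-shell tables). [this file, g89] -/
def CoreLabelTreeP (ϑc ϑp r rΘ q rsh ρ rm σ ϑr Rs ε rI ℓ Rd : ℝ) (N₀ H₀ : ℕ) (μC ΔC aHi Λ θ s : ℝ) : Prop :=
  ∀ δ : ℝ, 0 < δ → ∀ a : ℝ, 0 < a →
    ∀ S : Set E3, IsDoorSetP aHi δ S → (∀ z : E3, Summable fun y : S => lennardJones (dist z (y : E3))) →
      (∀ p ∈ S, IsTwoShellAffineGood θ S p) →
        ∀ (L : E3 ≃L[ℝ] E3) (w : ℤ → E3), IsEquilChart a s Λ L w →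
          ∀ (x₀ : E3) (K : Set E3), K ⊆ S → (∀ k ∈ K, dist k x₀ ≤ q) →
            IsTameOn ϑp S (LayeredHom (L : E3 →L[ℝ] E3) w) (coreOf S K rm) →
              IsTameOn ϑc S (LayeredHom (L : E3 →L[ℝ] E3) w) (moatIn S K r (r + rsh)) →
                ∀ (n : ℕ) (xf : Fin n → E3), Function.Injective xf → Set.range xf = coreOf S K ρ →
                  ∀ (L' : E3 →L[ℝ] E3) (w' : ℤ → E3) (U : E3 ≃ₗᵢ[ℝ] E3) (t : E3),
                    IsCoolShadowCrystal σ ϑr Rs ε r rI ℓ S K (LayeredHom (L : E3 →L[ℝ] E3) w) L' w' U t →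
                      ∀ lab : E3 → E3, IsBondLabel ε rΘ ℓ S K (placedCrystal L' w' U t) lab →
                        n ≤ N₀ ∧ (n ≠ 0 → ∃ (i₀ : Fin n) (par : Fin n → Fin n) (dep : Fin n → ℕ) (tri : Fin n → Fin 3 → Fin n),
                          IsLabelTree Rd μC ΔC H₀ (fun i => lab (xf i)) i₀ par dep tri)

/-- the explicit rigidity constant of the chain-Poincaré route is positive. -/
theorem labelChainRigidityConst_pos {N₀ H₀ : ℕ} {μC ΔC sv dB : ℝ} (hN : 0 < N₀) (hH : 0 < H₀) (hΔ : 0 ≤ ΔC) (hdB : 0 ≤ dB) (hsμ : sv < μC) :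
    0 < 1 / ((N₀ : ℝ) * (H₀ : ℝ) ^ 2 * (1 + 3 * (ΔC + 2 * dB) / (μC - sv)) ^ 2) := by
  have hμs : 0 < μC - sv := sub_pos.2 hsμ
  positivity

/-- ★★★ **THE GLUE (PROVED): (RGᴸ)(`cR = 1/(N₀·H₀²·(1 + 3(ΔC + 2dB₁)/(μC − sb₁))²)`) ⟸ (RG-lab)(N₀, H₀, μC, ΔC)** at pair range `Rd ≤ Rg` and tube radius
`0 ≤ sb₁ < μC`.  The VECTOR bond tube puts the filling's tripod vectors within `sb₁` of the label ones (tripods are in range `Rd ≤ Rg`) and its sites within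
`dB₁` of the labels; (RG-fin) then bounds the misfit from the root frame's rigid copy (rotation `V i₀`, proper because the field is) by
`n·(…)·D ≤ N₀·(…)·D`; an empty core has misfit `0`. [this file, g89] -/
theorem deficitRigidityP_of_coreLabelTree {ϑc ϑp r rΘ q rsh ρ rm σ ϑr Rs ε rI ℓ Rg sb₁ dI₁ dB₁ Rd μC ΔC aHi Λ θ s : ℝ} {N₀ H₀ : ℕ} (hN : 0 < N₀)
    (hH : 0 < H₀) (hΔ : 0 ≤ ΔC) (hRd : Rd ≤ Rg) (hsb₀ : 0 ≤ sb₁) (hsb : sb₁ < μC) (hdB₀ : 0 ≤ dB₁)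
    (hG : CoreLabelTreeP ϑc ϑp r rΘ q rsh ρ rm σ ϑr Rs ε rI ℓ Rd N₀ H₀ μC ΔC aHi Λ θ s) :
    DeficitRigidityP ϑc ϑp r rΘ q rsh ρ rm σ ϑr Rs ε rI ℓ Rg sb₁ dI₁ dB₁ Rd
      (1 / ((N₀ : ℝ) * (H₀ : ℝ) ^ 2 * (1 + 3 * (ΔC + 2 * dB₁) / (μC - sb₁)) ^ 2)) aHi Λ θ s := by
  intro δ hδ a ha S hS hsum hgood L w hLw x₀ K hKS hKq hmild hcool n xf hxf hrange L' w' U t hC lab hlab y hy V hV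
  obtain ⟨hn, htree⟩ := hG δ hδ a ha S hS hsum hgood L w hLw x₀ K hKS hKq hmild hcool n xf hxf hrange L' w' U t hC lab hlab
  have hμs : 0 < μC - sb₁ := sub_pos.2 hsb
  have hK : 0 < (N₀ : ℝ) * (H₀ : ℝ) ^ 2 * (1 + 3 * (ΔC + 2 * dB₁) / (μC - sb₁)) ^ 2 := by positivity
  have hD : 0 ≤ coreDeficit Rd (fun i => lab (xf i)) y xf V := coreDeficit_nonneg
  by_cases h0 : n = 0
  · subst h0
    refine ⟨LinearIsometryEquiv.refl ℝ E3, 0, det_refl_E3_eq_one, ?_⟩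
    have hz : rigidMisfit y xf (LinearIsometryEquiv.refl ℝ E3) 0 = 0 := by simp [rigidMisfit]
    rw [hz, mul_zero]
    exact hD
  · obtain ⟨i₀, par, dep, tri, hT⟩ := htree h0
    refine ⟨V i₀, xf i₀ - V i₀ (y i₀), hV i₀, ?_⟩
    have hy' := mem_bondTube_iff.1 hy
    have htube : ∀ j, dep j ≠ 0 → ∀ k, ‖(y (tri j k) - y j) - (lab (xf (tri j k)) - lab (xf j))‖ ≤ sb₁ := by
      intro j hj k
      rw [← dist_eq_norm]
      refine hy'.1 (tri j k) j ?_
      rw [dist_comm]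
      exact ((hT.2.2.2.2.1 j hj k).2).trans hRd
    have hpin : ∀ i, dist (y i) (lab (xf i)) ≤ dB₁ := fun i => hy'.2.2 i
    have hfin := rigidMisfit_root_le_of_labelTree (xf := xf) (V := V) hsb₀ hsb hT htube hpin
    have hnN : (n : ℝ) * (H₀ : ℝ) ^ 2 * (1 + 3 * (ΔC + 2 * dB₁) / (μC - sb₁)) ^ 2 ≤
        (N₀ : ℝ) * (H₀ : ℝ) ^ 2 * (1 + 3 * (ΔC + 2 * dB₁) / (μC - sb₁)) ^ 2 := by
      have : (n : ℝ) ≤ N₀ := by exact_mod_cast hn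
      gcongr
    rw [one_div, inv_mul_le_iff₀ hK]
    exact hfin.trans (mul_le_mul_of_nonneg_right hnN hD)

end Reduction

/-! ### ZZZXA-3  The doors: [MCMC♮] from (RG-lab) (PROVED) -/

section Doors

/-- ★★★ **THE DOOR W2c WITH GRAPH RIGIDITY DISCHARGED TO LABEL GEOMETRY (PROVED)**: `[MCMC♮](ϑc) ⟸ (SC♮) ∧ (X1ᴸ)(lam > 0) ∧ (X2ᴸ) ∧ (RG-lab)(N₀, H₀, μC, ΔC) ∧
(DWᴹ)(cE, σ₀)` with `σ₀ < cE·cR·10⁻⁴`, `cR = 1/(N₀·H₀²·(1 + 3(ΔC + 2dB₁)/(μC − sb₁))²)`, for `249/20000 < μC` — tree ZZZWB's W2c⁺ door with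
`hRG := deficitRigidityP_of_coreLabelTree` (`Rd = Rg = 121/25`, `sb₁ ≤ 249/20000 < μC`). [this file, g89] -/
theorem mildCoherentMoatCorePG_W2c_of_labelTree {ϑc sb₁ dI₁ dB₁ lam cE σ₀ μC ΔC : ℝ} {N₀ H₀ : ℕ} (hlam : 0 < lam) (hcE : 0 ≤ cE) (hN : 0 < N₀)
    (hH : 0 < H₀) (hμ : 249 / 20000 < μC) (hΔ : 0 ≤ ΔC)
    (hgap : σ₀ < cE * (1 / ((N₀ : ℝ) * (H₀ : ℝ) ^ 2 * (1 + 3 * (ΔC + 2 * dB₁) / (μC - sb₁)) ^ 2) * (1 / 10000))) (hsb : 4 * sb₁ ≤ 249 / 5000)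
    (hdI : 4 * dI₁ ≤ 249 / 5000) (hdB : dB₁ ≤ 2 / 5) (hsb₀ : 0 ≤ sb₁) (hdI₀ : 0 ≤ dI₁) (hdB₀ : 0 ≤ dB₁)
    (hSC : CoherentZoneShadowCrystalP ϑc (1 / 10) 8 4 12 16 (17 / 20) (1 / 10000) 5 (1 / 10000) 10 (43 / 2) 1 2 (1 / 16) (1 / 50))
    (hX1 : LabelTubeConvexityP ϑc tameRadius (1 / 10) 8 (145 / 16) 4 12 16 16 (17 / 20) (1 / 10000) 5 (1 / 10000) 10 (43 / 2) (1 / 5000) (121 / 25)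
      (249 / 5000) (249 / 5000) (21 / 50) lam 1 2 (1 / 16) (1 / 50))
    (hX2 : LabelLoadedTubeAprioriP ϑc tameRadius (1 / 10) 8 (145 / 16) 4 12 16 16 (17 / 20) (1 / 10000) 5 (1 / 10000) 10 (43 / 2) (1 / 5000)
      (121 / 25) (249 / 5000) (249 / 5000) (21 / 50) sb₁ dI₁ dB₁ 1 2 (1 / 16) (1 / 50))
    (hLT : CoreLabelTreeP ϑc (1 / 10) 8 (145 / 16) 4 12 16 16 (17 / 20) (1 / 10000) 5 (1 / 10000) 10 (43 / 2) (121 / 25) N₀ H₀ μC ΔC 1 2 (1 / 16)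
      (1 / 50))
    (hDW : DeficitWellMinP ϑc tameRadius (1 / 10) 8 (145 / 16) 4 12 16 16 (17 / 20) (1 / 10000) 5 (1 / 10000) 10 (43 / 2) (121 / 25) sb₁ dI₁ dB₁
      (121 / 25) cE σ₀ 1 2 (1 / 16) (1 / 50)) :
    MildCoherentMoatCorePG ϑc tameRadius (1 / 10) 8 4 12 16 1 2 (1 / 16) (1 / 50) :=
  have hsμ : sb₁ < μC := by linarith
  mildCoherentMoatCorePG_W2c_of_labelChain hlam (labelChainRigidityConst_pos hN hH hΔ hdB₀ hsμ).le hcE hgap hsb hdI hdB hsb₀ hdI₀ hdB₀ hSC hX1 hX2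
    (deficitRigidityP_of_coreLabelTree hN hH hΔ le_rfl hsb₀ hsμ hdB₀ hLT) hDW

/-- ★★★★ **THE DOOR OF RECORD AT THE EXACT WELL (PROVED) — `[MCMC♮](ϑc) ⟸ (SC♮) ∧ (X1ᴸ)(lam > 0) ∧ (X2ᴸ) ∧ (RG-lab)(N₀, H₀, μC, ΔC) ∧ (DWᴹ)(cE, 0)`,
`0 < cE`, `249/20000 < μC`** (critic row 1586, SCOPE-RG ruling: `σ₀ := 0` of record): the side condition `0 < cE·cR·10⁻⁴` holds for the explicit `cR > 0` of the
chain-Poincaré glue, so NO rigidity constant appears among the hypotheses.  Residual leaves of the W2 line: (SC♮) [KINEMATIC · ATTACKABLE], (X1ᴸ)/(X2ᴸ)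
[ANALYTIC · HEAVY], (RG-lab) [KINEMATIC · S-side, y-free · ATTACKABLE-S], (DWᴹ)(cE, 0) [ENERGETIC · exact well]. [this file, g89] -/
theorem mildCoherentMoatCorePG_W2c_exactWell_labelTree {ϑc sb₁ dI₁ dB₁ lam cE μC ΔC : ℝ} {N₀ H₀ : ℕ} (hlam : 0 < lam) (hcE : 0 < cE) (hN : 0 < N₀) (hH : 0 < H₀)
    (hμ : 249 / 20000 < μC) (hΔ : 0 ≤ ΔC) (hsb : 4 * sb₁ ≤ 249 / 5000) (hdI : 4 * dI₁ ≤ 249 / 5000) (hdB : dB₁ ≤ 2 / 5) (hsb₀ : 0 ≤ sb₁)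
    (hdI₀ : 0 ≤ dI₁) (hdB₀ : 0 ≤ dB₁)
    (hSC : CoherentZoneShadowCrystalP ϑc (1 / 10) 8 4 12 16 (17 / 20) (1 / 10000) 5 (1 / 10000) 10 (43 / 2) 1 2 (1 / 16) (1 / 50))
    (hX1 : LabelTubeConvexityP ϑc tameRadius (1 / 10) 8 (145 / 16) 4 12 16 16 (17 / 20) (1 / 10000) 5 (1 / 10000) 10 (43 / 2) (1 / 5000) (121 / 25)
      (249 / 5000) (249 / 5000) (21 / 50) lam 1 2 (1 / 16) (1 / 50))
    (hX2 : LabelLoadedTubeAprioriP ϑc tameRadius (1 / 10) 8 (145 / 16) 4 12 16 16 (17 / 20) (1 / 10000) 5 (1 / 10000) 10 (43 / 2) (1 / 5000)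
      (121 / 25) (249 / 5000) (249 / 5000) (21 / 50) sb₁ dI₁ dB₁ 1 2 (1 / 16) (1 / 50))
    (hLT : CoreLabelTreeP ϑc (1 / 10) 8 (145 / 16) 4 12 16 16 (17 / 20) (1 / 10000) 5 (1 / 10000) 10 (43 / 2) (121 / 25) N₀ H₀ μC ΔC 1 2 (1 / 16)
      (1 / 50))
    (hDW : DeficitWellMinP ϑc tameRadius (1 / 10) 8 (145 / 16) 4 12 16 16 (17 / 20) (1 / 10000) 5 (1 / 10000) 10 (43 / 2) (121 / 25) sb₁ dI₁ dB₁
      (121 / 25) cE 0 1 2 (1 / 16) (1 / 50)) :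
    MildCoherentMoatCorePG ϑc tameRadius (1 / 10) 8 4 12 16 1 2 (1 / 16) (1 / 50) :=
  have hsμ : sb₁ < μC := by linarith
  mildCoherentMoatCorePG_W2c_of_labelTree hlam hcE.le hN hH hμ hΔ
    (mul_pos hcE (mul_pos (labelChainRigidityConst_pos hN hH hΔ hdB₀ hsμ) (by norm_num))) hsb hdI hdB hsb₀ hdI₀ hdB₀ hSC hX1 hX2 hLT hDW

end Doors

end Summit.AtomisticToContinuum.Crystallization.Theorems.ChartedZeroExcessLayeredLatticeLiouville

end
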